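import Literature.Barriers.MatrixMultiplication.EquivoluminousBarrier
import Literature.Combinatorics.Additive.SliceRankMethod
import HarnessLib

/-!
# Proof of the equivoluminous-subsets barrier: the Naslund–Sawin sunflower bound via slice rank

Topic `Literature/Barriers/MatrixMultiplication`. This file DISCHARGES the named facts of
`EquivoluminousBarrier.lean` (no new definitions; statements there are unchanged):

* `NaslundSawin2017_thm3_holds : NaslundSawin2017_thm3` — **Naslund–Sawin 2017, Theorem 3**: a
  sunflower-free family `𝓕` of subsets of an `n`-set satisfies
  `|𝓕| ≤ 3(n+1) ∑_{k ≤ n/3} binom(n,k)`, PROVED here following the printed proof (§2 of the paper)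
  on top of the tree's slice-rank method file `Literature/Combinatorics/Additive/SliceRankMethod.lean`
  (Tao's lemma `HasSliceRankLE.card_le_of_matching` and the grouping lemma
  `hasSliceRankLE_of_cover`);
* `CoppersmithWinograd1990_sec11_holds : CoppersmithWinograd1990_sec11` — CW's §11 implication
  "hypothesis ⇒ `ω = 2`" holds VACUOUSLY: its antecedent `CWEquivoluminousHypothesis` is refuted
  in `EquivoluminousBarrier.lean` (`not_cwEquivoluminousHypothesis`) from Theorem 3; nothing of
  CW's tensor-power / Fourier argument is formalised (none is needed for the implication);
* the catalogue entry `EquivoluminousBarrier_holds : EquivoluminousBarrier`, and the unconditional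
  refutation `not_cwEquivoluminousHypothesis_unconditional`;
* the refutation with its RATE, unconditionally (`NoThreeDisjointEquivoluminous.log_card_ge_rate`,
  `.logb_card_ge_rate`, `.logb_card_div_card_ge`): every pair `(G, S)` with the CW property has
  `log₂|G| ≥ |S| · log₂((2/3)·2^{2/3}) − log₂(3(|S|+1))`, i.e. `(log₂|G|)/|S| ≥ 0.0817… − o(1)` —
  the logarithm of the proved inequality `2^{|S|} ≤ |G| · 3(|S|+1) · 2^{⌊|S|/3⌋} (3/2)^{|S|}`
  (`NoThreeDisjointEquivoluminous.two_pow_le_real` of the barrier file, now fed with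
  `NaslundSawin2017_thm3_holds`); this is the quantitative content of "the cap set bounds …
  disprove the Coppersmith–Winograd 'no three disjoint equivoluminous subsets' conjecture"
  (BCCGNSU 2017, §1) and the corrected, provable counterpart of the refuted working hypothesis
  `CWEquivoluminousHypothesis` of CW 1990, §11 ("Assume for now that we can find a sequence of
  pairs …"; "We have not been able to determine whether there exist such pairs").

## The printed proof of Theorem 3 (Naslund–Sawin 2017, §2) and its formalisation

Subsets `A, B, C` of the ground set `X` (`|X| = n`) are the three arguments of the **Naslund–Sawin
tensor** `T(A,B,C) = ∏_{i ∈ X} (2 − ([i∈A] + [i∈B] + [i∈C]))` ("`T(x,y,z) = ∏ᵢ (2 − (xᵢ+yᵢ+zᵢ))`"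
for the indicator vectors), written inline below as
`∏ l : X, (2 − [l∈A] − [l∈B] − [l∈C])` over `ℚ` (the paper says `ℝ`, "though we could have done
the same thing in any field of sufficiently large characteristic"). A factor vanishes exactly when
its coordinate lies in exactly two of the three sets (pattern `{1,1,0}`); diagonal factors are `2`
or `−1`.

1. *Layers are diagonal* (`nsTensor_ne_zero_iff`): if `𝓕` is sunflower-free and `A, B, C ∈ 𝓕`
   have the same cardinality ("`S_l` … the elements of `S` with exactly `l` ones"), then
   `T(A,B,C) ≠ 0 ↔ A = B = C` — for three distinct sets a sunflower is excluded, and "the only new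
   case is when two are equal and the third is not (say `x = y` and `z` is distinct), and then
   because `x ≠ z`, `x` is not a subset of `z`, so there exists some `i` such that `x_i = y_i = 1`
   and `z_i = 0`". Hence by Tao's lemma `|𝓕 ∩ layer k| ≤ #slices` (`card_layer_le`).
2. *Slice rank of `T`* (`hasSliceRankLE_nsTensor`): write `2 − a − b − c =
   (2/3 − a) + (2/3 − b) + (2/3 − c)` and expand the product over `X` into `3ⁿ` rank-one terms
   indexed by colourings `ω : X → Fin 3` (which bracket is taken at each coordinate); the `x`-factor
   of the term `ω` depends only on the colour class `ω⁻¹(0)`, etc. The three classes have total size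
   `n`, so one of them has at most `⌊n/3⌋` elements; grouping the terms by that class
   ("for each term … choose one of total degree at most `n/3` … each of these sums is a slice")
   gives at most `3 ∑_{j ≤ n/3} binom(n,j)` slices (`card_lowMonomials`).
3. *Summation over layers*: `|𝓕| = ∑_{k=0}^{n} |𝓕 ∩ layer k| ≤ 3(n+1) ∑_{j ≤ n/3} binom(n,j)`.

## References

* E. Naslund, W. F. Sawin, *Upper bounds for sunflower-free sets*, Forum Math. Sigma 5 (2017)
  e15, arXiv:1606.09575 (held: `paper:arxiv-1606.09575`; Theorem 3 on p. 3, its proof = §2 on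
  p. 5, Tao's Lemma 6 on p. 4 of the held text). [NaslundSawin2017]
* D. Coppersmith, S. Winograd, *Matrix multiplication via arithmetic progressions*, J. Symbolic
  Comput. 9 (1990) 251–280, §11 (held: `paper:doi-10-1016-s0747-7171-08-80013-2`, pp. 27–29 of
  the scan). [CoppersmithWinograd1990]
* J. Blasiak, T. Church, H. Cohn, J. A. Grochow, E. Naslund, W. F. Sawin, C. Umans, *On cap sets
  and the group-theoretic approach to matrix multiplication*, Discrete Analysis 2017:3,
  arXiv:1605.06702, §1 (p. 2) and Thm. A′ (the rate `(2/3)2^{2/3}`).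
  [BlasiakChurchCohnGrochowNaslundSawinUmans2017]
-/

noncomputable section

open scoped BigOperators
open Finset

namespace Literature.Barriers.MatrixMultiplication

open Literature.Combinatorics.Additive

universe u

section NaslundSawin

variable {α : Type u} [DecidableEq α]

/-! ## The diagonal layers of the Naslund–Sawin tensor -/

/-- **Layers of a sunflower-free family are diagonal for the Naslund–Sawin tensor**
`T(A,B,C) = ∏_{i∈X} (2 − ([i∈A]+[i∈B]+[i∈C]))` (Naslund–Sawin 2017, §2: "for each `l`, `S_l` is a
sunflower-free collection of subsets with none a proper subset of another, hence whenever
`x, y, z ∈ S_l` satisfy `x + y + z ∉ {0,1,3}ⁿ` we must have `x = y = z`" and "`T(x,y,z)` is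
nonvanishing precisely on triples `x, y, z` such that there does not exist `i` where
`{x_i, y_i, z_i} = {1,1,0}`"): for members `A, B ⊆ X`, `C` of a sunflower-free family with
`|A| = |B| = |C|`, `T(A,B,C) ≠ 0 ↔ A = B = C`. [cite: NaslundSawin2017, §2 (proof of Thm. 3)] -/
theorem nsTensor_ne_zero_iff {X : Finset α} {𝓕 : Finset (Finset α)} (h𝓕 : IsSunflowerFree 𝓕)
    {A B C : Finset α} (hA : A ∈ 𝓕) (hB : B ∈ 𝓕) (hC : C ∈ 𝓕) (hAX : A ⊆ X) (hBX : B ⊆ X)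
    (hAB : A.card = B.card) (hBC : B.card = C.card) :
    (∏ l : X, (2 - (if (l : α) ∈ A then 1 else 0) - (if (l : α) ∈ B then 1 else 0)
        - (if (l : α) ∈ C then 1 else 0) : ℚ)) ≠ 0 ↔ (A = B ∧ B = C) := by
  refine ⟨fun hne => ?_, ?_⟩
  · have hf : ∀ i ∈ X, (2 - (if i ∈ A then 1 else 0) - (if i ∈ B then 1 else 0)
        - (if i ∈ C then 1 else 0) : ℚ) ≠ 0 := fun i hi =>
      (Finset.prod_ne_zero_iff.1 hne) ⟨i, hi⟩ (Finset.mem_univ _)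
    -- no coordinate lies in exactly two of the three sets (pattern `{1,1,0}`)
    have h1 : ∀ i, i ∈ A → i ∈ B → i ∈ C := fun i hiA hiB =>
      by_contra fun hiC => hf i (hAX hiA) (by rw [if_pos hiA, if_pos hiB, if_neg hiC]; norm_num)
    have h2 : ∀ i, i ∈ A → i ∈ C → i ∈ B := fun i hiA hiC =>
      by_contra fun hiB => hf i (hAX hiA) (by rw [if_pos hiA, if_neg hiB, if_pos hiC]; norm_num)
    have h3 : ∀ i, i ∈ B → i ∈ C → i ∈ A := fun i hiB hiC =>
      by_contra fun hiA => hf i (hBX hiB) (by rw [if_neg hiA, if_pos hiB, if_pos hiC]; norm_num)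
    by_cases hab : A = B
    · -- `A = B ⊆ C` and `|C| = |A|`
      refine ⟨hab, ?_⟩
      rw [← hab]
      exact Finset.eq_of_subset_of_card_le (fun i hi => h1 i hi (by rw [← hab]; exact hi))
        (by omega)
    by_cases hac : A = C
    · exact absurd (Finset.eq_of_subset_of_card_le
        (fun i hi => h2 i hi (by rw [← hac]; exact hi)) (by omega)) hab
    by_cases hbc : B = C
    · exact absurd (Finset.eq_of_subset_of_card_le
        (fun i hi => h3 i hi (by rw [← hbc]; exact hi)) (by omega)).symm hab
    -- three distinct members: they would form a sunflower with kernel `A ∩ B = A ∩ C = B ∩ C`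
    exfalso
    refine h𝓕 A hA B hB C hC hab hbc hac ⟨?_, ?_⟩
    · ext i
      simp only [Finset.mem_inter]
      exact ⟨fun h => ⟨h.1, h1 i h.1 h.2⟩, fun h => ⟨h.1, h2 i h.1 h.2⟩⟩
    · ext i
      simp only [Finset.mem_inter]
      exact ⟨fun h => ⟨h.2, h1 i h.1 h.2⟩, fun h => ⟨h3 i h.1 h.2, h.1⟩⟩
  · -- diagonal factors are `2` or `-1`
    rintro ⟨rfl, rfl⟩
    exact Finset.prod_ne_zero_iff.2 fun l _ => by split_ifs <;> norm_num

/-- **Per-layer bound** (Naslund–Sawin 2017, §2: "restricted to `S_l × S_l × S_l`, `T(x,y,z)` is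
nonzero if and only if `x = y = z`. So by Lemma [Tao] the slice rank of `T` is at least `|S_l|`"):
the members of cardinality `k` of a sunflower-free family of subsets of `X` number at most the size
of any slice decomposition of `T` (Tao's lemma in the tree's form
`HasSliceRankLE.card_le_of_matching`). [cite: NaslundSawin2017, §2 (proof of Thm. 3)] -/
theorem card_layer_le {X : Finset α} {𝓕 : Finset (Finset α)} (h𝓕X : ∀ A ∈ 𝓕, A ⊆ X)
    (h𝓕 : IsSunflowerFree 𝓕) {m : ℕ}
    (hD : HasSliceRankLE (fun A B C : Finset α => ∏ l : X,
      (2 - (if (l : α) ∈ A then 1 else 0) - (if (l : α) ∈ B then 1 else 0)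
        - (if (l : α) ∈ C then 1 else 0) : ℚ)) m) (k : ℕ) :
    (𝓕.filter fun A => A.card = k).card ≤ m := by
  have h := hD.card_le_of_matching (ι := ↥(𝓕.filter fun A => A.card = k))
    (fun A => (A : Finset α)) (fun A => (A : Finset α)) (fun A => (A : Finset α)) ?_
  · rwa [Fintype.card_coe] at h
  · rintro ⟨A, hA⟩ ⟨B, hB⟩ ⟨C, hC⟩
    rw [Finset.mem_filter] at hA hB hC
    refine (nsTensor_ne_zero_iff h𝓕 hA.1 hB.1 hC.1 (h𝓕X A hA.1) (h𝓕X B hB.1)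
      (hA.2.trans hB.2.symm) (hB.2.trans hC.2.symm)).trans ?_
    simp only [Subtype.mk.injEq]

/-! ## The slice decomposition of `T` -/

omit [DecidableEq α] in
/-- Counting the slices: the "monomials of degree at most `n/3`", i.e. the subsets `P` of the
ground set with `|P| = j ≤ ⌊n/3⌋` (as a sigma type over `j`), number `∑_{j ≤ n/3} binom(n,j)`
(Naslund–Sawin 2017, §2: "the number of monomials in `n` variables of degree at most `1` in each
variable and of total degree at most `n/3` … is exactly `∑_{k ≤ n/3} binom(n,k)`").
[cite: NaslundSawin2017, §2 (proof of Thm. 3)] -/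
theorem card_lowMonomials (X : Finset α) :
    Fintype.card (Σ j : Fin (X.card / 3 + 1),
        ↥(Finset.powersetCard (j : ℕ) (Finset.univ : Finset X))) =
      ∑ j ∈ Finset.range (X.card / 3 + 1), X.card.choose j := by
  rw [Fintype.card_sigma]
  simp only [Fintype.card_coe, Finset.card_powersetCard, Finset.card_univ]
  exact Fin.sum_univ_eq_sum_range (fun j => X.card.choose j) (X.card / 3 + 1)

/-- **Slice rank of the Naslund–Sawin tensor** (Naslund–Sawin 2017, §2: "Expanding the product form
for `T(x,y,z)`, we may write `T` as a linear combination of products of three monomials … with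
`i_1 + ⋯ + i_n + j_1 + ⋯ + j_n + k_1 + ⋯ + k_n ≤ n`. For each product of three monomials, at least
one of [the three degrees] is at most `n/3` … The total slice rank is at most …
`3 ∑_{k ≤ n/3} binom(n,k)`"): `T` has a slice decomposition with at most
`3 ∑_{j ≤ n/3} binom(n,j)` slices. Here the expansion is organised as `2 − a − b − c =
(2/3 − a) + (2/3 − b) + (2/3 − c)`, one rank-one term per colouring `ω : X → Fin 3`, grouped
(`hasSliceRankLE_of_cover`) by the first colour whose class has at most `⌊n/3⌋` elements.
[cite: NaslundSawin2017, §2 (proof of Thm. 3)] -/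
theorem hasSliceRankLE_nsTensor (X : Finset α) :
    HasSliceRankLE (fun A B C : Finset α => ∏ l : X,
      (2 - (if (l : α) ∈ A then 1 else 0) - (if (l : α) ∈ B then 1 else 0)
        - (if (l : α) ∈ C then 1 else 0) : ℚ))
      (3 * ∑ j ∈ Finset.range (X.card / 3 + 1), X.card.choose j) := by
  classical
  -- one third of a factor, attached to one of the three sets
  set g : Finset α → X → ℚ := fun A l => 2 / 3 - (if (l : α) ∈ A then 1 else 0) with hg
  have hfac : ∀ (A B C : Finset α) (l : X),
      (2 - (if (l : α) ∈ A then 1 else 0) - (if (l : α) ∈ B then 1 else 0)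
        - (if (l : α) ∈ C then 1 else 0) : ℚ) = g A l + g B l + g C l := by
    intro A B C l
    simp only [hg]
    ring
  -- the rank-one terms, indexed by colourings `ω : X → Fin 3`
  set Fx : (X → Fin 3) → Finset α → ℚ := fun ω A => ∏ l, if ω l = 0 then g A l else 1 with hFx
  set Fy : (X → Fin 3) → Finset α → ℚ := fun ω B => ∏ l, if ω l = 1 then g B l else 1 with hFy
  set Fz : (X → Fin 3) → Finset α → ℚ := fun ω C => ∏ l, if ω l = 2 then g C l else 1 with hFz
  have hD : ∀ A B C : Finset α,
      (∏ l : X, (2 - (if (l : α) ∈ A then 1 else 0) - (if (l : α) ∈ B then 1 else 0)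
        - (if (l : α) ∈ C then 1 else 0) : ℚ)) = ∑ ω : X → Fin 3, Fx ω A * Fy ω B * Fz ω C := by
    intro A B C
    have h1 : (∏ l : X, (2 - (if (l : α) ∈ A then 1 else 0) - (if (l : α) ∈ B then 1 else 0)
        - (if (l : α) ∈ C then 1 else 0) : ℚ)) =
        ∏ l : X, ∑ k : Fin 3, (if k = 0 then g A l else if k = 1 then g B l else g C l) := by
      refine Finset.prod_congr rfl fun l _ => ?_
      rw [hfac A B C l, Fin.sum_univ_three]
      simp
    rw [h1, Fintype.prod_sum]
    refine Finset.sum_congr rfl fun ω _ => ?_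
    simp only [hFx, hFy, hFz]
    rw [← Finset.prod_mul_distrib, ← Finset.prod_mul_distrib]
    refine Finset.prod_congr rfl fun l _ => ?_
    generalize ω l = k
    fin_cases k <;> simp
  -- sizes of the colour classes
  set cnt : Fin 3 → (X → Fin 3) → ℕ := fun i ω => (Finset.univ.filter fun l => ω l = i).card
    with hcnt
  have hsum : ∀ ω : X → Fin 3, cnt 0 ω + cnt 1 ω + cnt 2 ω = X.card := by
    intro ω
    have h := Finset.card_eq_sum_card_fiberwise (f := ω) (s := Finset.univ)
      (t := (Finset.univ : Finset (Fin 3))) fun l _ => Finset.mem_univ _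
    simp only [Fin.sum_univ_three, Finset.card_univ, Fintype.card_coe] at h
    simp only [hcnt]
    omega
  have hthird : ∀ ω : X → Fin 3, ¬ cnt 0 ω ≤ X.card / 3 → ¬ cnt 1 ω ≤ X.card / 3 →
      cnt 2 ω ≤ X.card / 3 := by
    intro ω h0 h1
    have h := hsum ω
    omega
  -- the class of a colouring: the first colour whose class is small
  set c : (X → Fin 3) → Fin 3 := fun ω =>
    if cnt 0 ω ≤ X.card / 3 then 0 else if cnt 1 ω ≤ X.card / 3 then 1 else 2 with hc
  -- projections to the index set (low monomials) and the slice functions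
  set s₀ : (Σ j : Fin (X.card / 3 + 1), ↥(Finset.powersetCard (j : ℕ) (Finset.univ : Finset X))) :=
    ⟨⟨0, Nat.succ_pos _⟩,
      ⟨∅, Finset.mem_powersetCard.2 ⟨Finset.empty_subset _, Finset.card_empty⟩⟩⟩ with hs₀
  set π : Fin 3 → (X → Fin 3) →
      (Σ j : Fin (X.card / 3 + 1), ↥(Finset.powersetCard (j : ℕ) (Finset.univ : Finset X))) :=
    fun i ω =>
      if h : cnt i ω ≤ X.card / 3 then
        ⟨⟨cnt i ω, Nat.lt_succ_of_le h⟩,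
          ⟨Finset.univ.filter fun l => ω l = i,
            Finset.mem_powersetCard.2 ⟨Finset.subset_univ _, rfl⟩⟩⟩
      else s₀ with hπ
  set φ : (Σ j : Fin (X.card / 3 + 1), ↥(Finset.powersetCard (j : ℕ) (Finset.univ : Finset X))) →
      Finset α → ℚ := fun s A => ∏ l ∈ (s.2 : Finset X), g A l with hφ
  have hclass : ∀ (i : Fin 3) (ω : X → Fin 3), cnt i ω ≤ X.card / 3 →
      (fun A => ∏ l, if ω l = i then g A l else 1) = φ (π i ω) := by
    intro i ω h
    funext A
    simp only [hπ, dif_pos h, hφ]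
    rw [Finset.prod_filter]
  have hx : ∀ ω, c ω = 0 → Fx ω = φ (π 0 ω) := by
    intro ω h0
    have h' : cnt 0 ω ≤ X.card / 3 := by
      by_contra hno
      simp only [hc, if_neg hno] at h0
      split_ifs at h0 <;> exact absurd h0 (by decide)
    exact hclass 0 ω h'
  have hy : ∀ ω, c ω = 1 → Fy ω = φ (π 1 ω) := by
    intro ω h1
    have hno0 : ¬ cnt 0 ω ≤ X.card / 3 := by
      intro h0
      simp only [hc, if_pos h0] at h1
      exact absurd h1 (by decide)
    have h' : cnt 1 ω ≤ X.card / 3 := by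
      by_contra hno
      simp only [hc, if_neg hno0, if_neg hno] at h1
      exact absurd h1 (by decide)
    exact hclass 1 ω h'
  have hz : ∀ ω, c ω = 2 → Fz ω = φ (π 2 ω) := by
    intro ω h2
    have hno0 : ¬ cnt 0 ω ≤ X.card / 3 := by
      intro h0
      simp only [hc, if_pos h0] at h2
      exact absurd h2 (by decide)
    have hno1 : ¬ cnt 1 ω ≤ X.card / 3 := by
      intro h1
      simp only [hc, if_neg hno0, if_pos h1] at h2
      exact absurd h2 (by decide)
    exact hclass 2 ω (hthird ω hno0 hno1)
  refine (hasSliceRankLE_of_cover _ Fx Fy Fz hD c (π 0) φ hx (π 1) φ hy (π 2) φ hz).mono ?_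
  rw [card_lowMonomials]
  omega

/-! ## Theorem 3 and the catalogue entry -/

/-- **Naslund–Sawin 2017, Theorem 3, PROVED**: a sunflower-free family `𝓕` of subsets of an
`n`-element set `X` has `|𝓕| ≤ 3(n+1) ∑_{k ≤ n/3} binom(n,k)` — summing the per-layer bound
(`card_layer_le` with `hasSliceRankLE_nsTensor`) over the `n + 1` layers `|A| = 0, …, n`
("`|S| ≤ ∑_{l=0}^{n} |S_l| ≤ 3(n+1) ∑_{k ≤ n/3} binom(n,k)`"). [cite: NaslundSawin2017, Thm. 3] -/
theorem NaslundSawin2017_thm3_holds : NaslundSawin2017_thm3 := by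
  intro α _ X 𝓕 h𝓕X h𝓕
  have hD := hasSliceRankLE_nsTensor X
  calc 𝓕.card = ∑ k ∈ Finset.range (X.card + 1), (𝓕.filter fun A => A.card = k).card :=
        Finset.card_eq_sum_card_fiberwise fun A hA =>
          Finset.mem_range.2 (Nat.lt_succ_of_le (Finset.card_le_card (h𝓕X A hA)))
    _ ≤ ∑ _k ∈ Finset.range (X.card + 1),
          3 * ∑ j ∈ Finset.range (X.card / 3 + 1), X.card.choose j :=
        Finset.sum_le_sum fun k _ => card_layer_le h𝓕X h𝓕 hD k
    _ = 3 * (X.card + 1) * ∑ j ∈ Finset.range (X.card / 3 + 1), X.card.choose j := by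
        rw [Finset.sum_const, Finset.card_range, smul_eq_mul]
        ring

end NaslundSawin

/-- **Coppersmith–Winograd 1990, §11, as an implication, holds — vacuously**: the named fact
`CoppersmithWinograd1990_sec11` is `CWEquivoluminousHypothesis → ω(ℂ) = 2`, and its antecedent
(pairs `(G,S)` with no three disjoint equivoluminous subsets and `log₂|G| = o(|S|)`) is REFUTED by
`not_cwEquivoluminousHypothesis` from the sunflower bound, now a theorem
(`NaslundSawin2017_thm3_holds`). This records no information about `ω` and formalises nothing of
CW's tensor-power argument ("With the assumption that `ζ = (log₂|G|)/|S|` approaches `0`, this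
would yield `ω = 2`. We have not been able to determine whether there exist such pairs `(G,S)`").
[cite: CoppersmithWinograd1990, §11] -/
theorem CoppersmithWinograd1990_sec11_holds : CoppersmithWinograd1990_sec11 :=
  fun h => absurd h (not_cwEquivoluminousHypothesis NaslundSawin2017_thm3_holds)

/-- **The equivoluminous-subsets barrier holds**: the catalogue entry `EquivoluminousBarrier`
(Naslund–Sawin 2017 Thm. 3 ∧ the CW §11 implication) is a theorem; in particular CW's §11
hypothesis is false unconditionally (`EquivoluminousBarrier_holds.hypothesis_false`).
[cite: NaslundSawin2017, Thm. 3] -/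
theorem EquivoluminousBarrier_holds : EquivoluminousBarrier :=
  ⟨NaslundSawin2017_thm3_holds, CoppersmithWinograd1990_sec11_holds⟩

-- names the retired `@[deprecated]` record `CWEquivoluminousHypothesis` of `EquivoluminousBarrier.lean`
-- on purpose: this IS its unconditional refutation (verdict clean-up 2026-08-16); REMOVE-WHEN the
-- record is deleted from the barrier file
set_option linter.deprecated false in
/-- Unconditional form of the refutation of CW's §11 hypothesis: there is no sequence of pairs
`(G, S)` with the no-three-disjoint-equivoluminous-subsets property and `(log₂|G|)/|S| → 0`
("the cap set bounds … disprove the Coppersmith–Winograd 'no three disjoint equivoluminous subsets'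
conjecture"). [cite: BlasiakChurchCohnGrochowNaslundSawinUmans2017, §1 (p. 2)] -/
theorem not_cwEquivoluminousHypothesis_unconditional : ¬ CWEquivoluminousHypothesis :=
  EquivoluminousBarrier_holds.hypothesis_false

/-! ## The rate of the refutation, unconditionally

Coppersmith–Winograd 1990, §11 ASSUME pairs `(G, S)` with the no-three-disjoint-equivoluminous-
subsets property and `(log₂|G|)/|S| → 0` (`CWEquivoluminousHypothesis`, a working hypothesis they
leave open: "We have not been able to determine whether there exist such pairs"). What holds
instead, for EVERY pair, is the linear lower bound below: the logarithm of
`2^{|S|} ≤ |G| · 3(|S|+1) · 2^{⌊|S|/3⌋} (3/2)^{|S|}` (`NoThreeDisjointEquivoluminous.two_pow_le_real`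
with `NaslundSawin2017_thm3_holds`). The rate `log₂((2/3)·2^{2/3}) = 5/3 − log₂ 3 = 0.08170…` is
the constant of BCCGNSU 2017, Thm. A′ / the catalogue block of `EquivoluminousBarrier`. -/

section Rate

variable {G : Type} [AddCommGroup G] [DecidableEq G] [Fintype G]

/-- **Rate of the refutation, natural logarithms**: for every finite abelian group `G` and every
`S ⊆ G` with no three disjoint equivoluminous subsets,
`|S| · log((2/3)·2^{2/3}) − log(3(|S|+1)) ≤ log|G|` (unconditional; `log((2/3)2^{2/3}) =
(2/3) log 2 − log(3/2) = 0.0566…`). [cite: NaslundSawin2017, Thm. 3]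
[cite: BlasiakChurchCohnGrochowNaslundSawinUmans2017, §1 (p. 2)] -/
theorem NoThreeDisjointEquivoluminous.log_card_ge_rate {S : Finset G}
    (h : NoThreeDisjointEquivoluminous S) :
    (S.card : ℝ) * Real.log (2 ^ (2 / 3 : ℝ) * (2 / 3)) - Real.log (3 * (S.card + 1)) ≤
      Real.log (Fintype.card G) := by
  have hG0 : (0 : ℝ) < Fintype.card G := by exact_mod_cast Fintype.card_pos
  have hmain := h.two_pow_le_real NaslundSawin2017_thm3_holds
  have hl := Real.log_le_log (by positivity) hmain
  rw [Real.log_pow, Real.log_mul hG0.ne' (by positivity),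
    Real.log_mul (x := (3 * ((S.card : ℝ) + 1))) (by positivity) (by positivity),
    Real.log_mul (x := (2 : ℝ) ^ (S.card / 3)) (by positivity) (by positivity), Real.log_pow,
    Real.log_pow] at hl
  have hfloor : ((S.card / 3 : ℕ) : ℝ) * Real.log 2 ≤ (S.card : ℝ) / 3 * Real.log 2 :=
    mul_le_mul_of_nonneg_right Nat.cast_div_le (Real.log_nonneg (by norm_num))
  have hconst : Real.log (2 ^ (2 / 3 : ℝ) * (2 / 3)) = 2 / 3 * Real.log 2 - Real.log (3 / 2) := by
    rw [Real.log_mul (by positivity) (by norm_num), Real.log_rpow two_pos,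
      show (2 / 3 : ℝ) = (3 / 2)⁻¹ by norm_num, Real.log_inv]
    ring
  rw [hconst]
  linarith

/-- **Rate of the refutation, base 2** ("pairs `(G,S)` with no three disjoint equivoluminous
subsets have `log₂|G| ≥ c|S|`", quantitatively): for every finite abelian group `G` and every
`S ⊆ G` with the CW property, `|S| · log₂((2/3)·2^{2/3}) − log₂(3(|S|+1)) ≤ log₂|G|`, where
`log₂((2/3)·2^{2/3}) = 5/3 − log₂ 3 = 0.08170…`. Unconditional; this is the provable counterpart
of CW's refuted §11 hypothesis `CWEquivoluminousHypothesis` ("such that `(log₂|G|)/|S|`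
approaches `0`"). [cite: CoppersmithWinograd1990, §11] [cite: NaslundSawin2017, Thm. 3]
[cite: BlasiakChurchCohnGrochowNaslundSawinUmans2017, §1 (p. 2)] -/
theorem NoThreeDisjointEquivoluminous.logb_card_ge_rate {S : Finset G}
    (h : NoThreeDisjointEquivoluminous S) :
    (S.card : ℝ) * Real.logb 2 (2 ^ (2 / 3 : ℝ) * (2 / 3)) - Real.logb 2 (3 * (S.card + 1)) ≤
      Real.logb 2 (Fintype.card G) := by
  have h1 := h.log_card_ge_rate
  unfold Real.logb
  rw [mul_div_assoc', ← sub_div]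
  exact div_le_div_of_nonneg_right h1 (Real.log_nonneg one_le_two)

/-- The same as a bound on CW's ratio `ζ = (log₂|G|)/|S|` for nonempty `S`:
`log₂((2/3)·2^{2/3}) − log₂(3(|S|+1))/|S| ≤ (log₂|G|)/|S|`; so along any sequence of pairs
`liminf ζ ≥ 0.0817…`, and `ζ → 0` is impossible. [cite: CoppersmithWinograd1990, §11]
[cite: NaslundSawin2017, Thm. 3] -/
theorem NoThreeDisjointEquivoluminous.logb_card_div_card_ge {S : Finset G}
    (h : NoThreeDisjointEquivoluminous S) (hS : S.Nonempty) :
    Real.logb 2 (2 ^ (2 / 3 : ℝ) * (2 / 3)) - Real.logb 2 (3 * (S.card + 1)) / S.card ≤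
      Real.logb 2 (Fintype.card G) / S.card := by
  have hn : (0 : ℝ) < S.card := by exact_mod_cast hS.card_pos
  have h1 := h.logb_card_ge_rate
  rw [sub_div' hn.ne', div_le_div_iff_of_pos_right hn]
  linarith

end Rate

end Literature.Barriers.MatrixMultiplication

end
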